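import Summits.CriticalPhenomena.PercolationContinuityZ3.Theorems.AdditiveGluing.Negative.CertIsoSix

/-!
# `AdditiveGluing` (crux stmt-CriticalPhenomena-4576, route `PercNearOneGluing`):
# block pruning — a code-minimal graph has code-minimal top blocks

Lemma behind the seven-vertex search (`CertIsoSeven.lean`).  The code of a graph on `Fin n`
(`codeG`, bit `slot n i j = j + i·n` for an edge `i < j`) lists the rows `i = n−2, n−3, …, 0` from the
most to the least significant; the pairs inside the top block `{r, …, n−1}` are exactly those of slot
`≥ B_r := slot n r (r+1)` (`slot_ge_iff`).  Hence for a permutation `σ` fixing every vertex `< r`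
(`hiPart_codeG_map`): the high part of `codeG (G.map σ)` is the recoding of the high part of
`codeG G` — which is what the search computes at the moment the top block is complete — and
(`not_lt_hiPart_of_minimal`) if that recoding is SMALLER then `codeG (G.map σ) < codeG G` (the low
parts are `< 2^{B_r}`, the high parts multiples of it).  So a graph whose code is minimal in its orbit
survives every block test.  Also here: the list form `recodeL (smPairs n τ)` of `recode` used by the
search and the semantics of `fixesBelow`.  Nothing here asserts the crux.
-/

namespace Summit.CriticalPhenomena.PercolationContinuityZ3.Theorems.AdditiveGluing.Negative.Cert

/-! ### Computable pieces used by the search -/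

section Checker

/-- The (slot, image bit) pairs of a tabulated permutation, one per vertex pair. -/
def smPairs (n : ℕ) (τ : List (Fin n)) : List (ℕ × ℕ) :=
  (allPairs n).map fun p => (slot n p.1 p.2,
    2 ^ slot n (min (τ.getD p.1 p.1) (τ.getD p.2 p.2) : Fin n) (max (τ.getD p.1 p.1) (τ.getD p.2 p.2) : Fin n))

/-- Recode a code through (slot, image bit) pairs. -/
def recodeL (sp : List (ℕ × ℕ)) (c : ℕ) : ℕ :=
  sp.foldr (fun sv acc => if c.testBit sv.1 then acc ||| sv.2 else acc) 0

/-- Some recoding in the list lowers the code. -/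
def lowersL (sps : List (List (ℕ × ℕ))) (c : ℕ) : Bool := sps.any fun sp => Nat.blt (recodeL sp c) c

/-- The tabulated permutation fixes every vertex below `r`. -/
def fixesBelow {n : ℕ} (r : ℕ) (τ : List (Fin n)) : Bool :=
  (List.finRange n).all fun i => !(decide (i.val < r)) || (τ.getD i i == i)

/-- The high part of a code: the bits `≥ B`. -/
def hiPart (B c : ℕ) : ℕ := (c >>> B) <<< B

end Checker

/-! ### `recodeL` is `recode` -/

/-- The list form of `recode`. -/
theorem recodeL_smPairs (n : ℕ) (τ : List (Fin n)) (c : ℕ) : recodeL (smPairs n τ) c = recode n τ c := by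
  rw [smPairs, recodeL, List.foldr_map]; rfl

/-- What `lowersL` says. -/
theorem exists_of_lowersL {sps : List (List (ℕ × ℕ))} {c : ℕ} (h : lowersL sps c = true) :
    ∃ sp ∈ sps, recodeL sp c < c := by
  rw [lowersL, List.any_eq_true] at h
  obtain ⟨sp, hsp, hlt⟩ := h
  rw [Nat.blt_eq] at hlt
  exact ⟨sp, hsp, hlt⟩

/-- What `fixesBelow` says (for the table of a permutation). -/
theorem fix_of_fixesBelow {n r : ℕ} {τ : List (Fin n)} (h : fixesBelow r τ = true) {σ : Equiv.Perm (Fin n)}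
    (hτ : ∀ i : Fin n, τ.getD i i = σ i) (i : Fin n) (hi : i.val < r) : σ i = i := by
  rw [fixesBelow, List.all_eq_true] at h
  have := h i (List.mem_finRange i)
  rw [Bool.or_eq_true, Bool.not_eq_true', decide_eq_false_iff_not, beq_iff_eq, hτ] at this
  exact this.resolve_left (fun h' => h' hi)

/-! ### Bits of the high part; slots of the top block -/

/-- Bits of the high part. -/
theorem testBit_hiPart (B c k : ℕ) : (hiPart B c).testBit k = (decide (B ≤ k) && c.testBit k) := by
  unfold hiPart
  rw [Nat.testBit_shiftLeft]
  by_cases hk : B ≤ k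
  · simp only [hk, decide_true, Bool.true_and, Nat.testBit_shiftRight]
    congr 1; omega
  · simp [hk]

/-- `hiPart B c = c / 2^B * 2^B`. -/
theorem hiPart_eq (B c : ℕ) : hiPart B c = c / 2 ^ B * 2 ^ B := by
  rw [hiPart, Nat.shiftLeft_eq, Nat.shiftRight_eq_div_pow]

/-- `c = hiPart B c + c % 2^B`. -/
theorem hiPart_add_mod (B c : ℕ) : hiPart B c + c % 2 ^ B = c := by
  rw [hiPart_eq, Nat.div_add_mod']

/-- A pair `i < j` lies in the top block `{r, …}` iff its slot is at least `slot n r (r+1)`. -/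
theorem slot_ge_iff {n r : ℕ} {i j : ℕ} (hij : i < j) (hj : j < n) :
    slot n r (r + 1) ≤ slot n i j ↔ r ≤ i := by
  unfold slot
  constructor
  · intro h
    by_contra hri
    rw [not_le] at hri
    have h1 : (i + 1) * n ≤ r * n := Nat.mul_le_mul_right n hri
    nlinarith
  · intro h
    have h1 : r * n ≤ i * n := Nat.mul_le_mul_right n h
    omega

/-- A permutation fixing every vertex below `r` maps the top block onto itself. -/
theorem perm_ge_iff {n r : ℕ} (σ : Equiv.Perm (Fin n)) (hfix : ∀ i : Fin n, i.val < r → σ i = i) (x : Fin n) :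
    r ≤ (σ x).val ↔ r ≤ x.val := by
  constructor
  · intro h
    by_contra hx
    rw [not_le] at hx
    rw [hfix x hx] at h
    omega
  · intro h
    by_contra hσ
    rw [not_le] at hσ
    have h1 := hfix (σ x) hσ
    have h2 : σ x = x := σ.injective h1
    rw [h2] at hσ
    omega

/-! ### The key identity and the block lemma -/

/-- **Key identity.** For `σ` fixing every vertex below `r`: recoding the high part
of `codeG G` (the top block `{r, …, n−1}`) gives the high part of `codeG (G.map σ)`. -/
theorem recode_hiPart_codeG {n r : ℕ} (G : SimpleGraph (Fin n)) (σ : Equiv.Perm (Fin n))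
    (hfix : ∀ i : Fin n, i.val < r → σ i = i) (τ : List (Fin n)) (hτ : ∀ i : Fin n, τ.getD i i = σ i) :
    recode n τ (hiPart (slot n r (r + 1)) (codeG G)) = hiPart (slot n r (r + 1)) (codeG (G.map σ)) := by
  apply Nat.eq_of_testBit_eq
  intro k
  rw [Bool.eq_iff_iff, testBit_recode, testBit_hiPart, Bool.and_eq_true, decide_eq_true_eq, testBit_codeG]
  simp only [hτ, mem_allPairs, testBit_hiPart, Bool.and_eq_true, decide_eq_true_eq, testBit_codeG]
  constructor
  · rintro ⟨p, hp, ⟨hB, i, j, hij, hadj, hs⟩, rfl⟩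
    obtain ⟨h1, h2⟩ := slot_inj j.2 p.2.2 hs
    have hp' : p = (i, j) := Prod.ext (Fin.ext h1).symm (Fin.ext h2).symm
    subst hp'
    have hri : r ≤ i.val := (slot_ge_iff hij j.2).1 hB
    have hrj : r ≤ j.val := hri.trans hij.le
    have hne : σ i ≠ σ j := fun h => (G.ne_of_adj hadj) (σ.injective h)
    have hσi : r ≤ (σ i).val := (perm_ge_iff σ hfix i).2 hri
    have hσj : r ≤ (σ j).val := (perm_ge_iff σ hfix j).2 hrj
    have hlt : min (σ i) (σ j) < max (σ i) (σ j) := min_lt_max.2 hne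
    refine ⟨?_, min (σ i) (σ j), max (σ i) (σ j), hlt, ?_, rfl⟩
    · refine (slot_ge_iff (i := ((min (σ i) (σ j) : Fin n) : ℕ)) (j := ((max (σ i) (σ j) : Fin n) : ℕ))
        hlt (max (σ i) (σ j)).2).2 ?_
      rcases le_total (σ i) (σ j) with h | h
      · rw [min_eq_left h]; exact hσi
      · rw [min_eq_right h]; exact hσj
    · rw [SimpleGraph.map_adj']
      refine ⟨min_lt_max.2 hne |>.ne, ?_⟩
      rcases lt_or_gt_of_ne hne with h | h
      · exact ⟨i, j, hadj, (min_eq_left h.le).symm, (max_eq_right h.le).symm⟩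
      · exact ⟨j, i, hadj.symm, (min_eq_right h.le).symm, (max_eq_left h.le).symm⟩
  · rintro ⟨hB, c, d, hcd, hadj, rfl⟩
    rw [SimpleGraph.map_adj'] at hadj
    obtain ⟨-, u, v, huv, rfl, rfl⟩ := hadj
    have hrc : r ≤ (σ u).val := (slot_ge_iff hcd (σ v).2).1 hB
    have hru : r ≤ u.val := (perm_ge_iff σ hfix u).1 hrc
    have hrv : r ≤ v.val := (perm_ge_iff σ hfix v).1 (hrc.trans hcd.le)
    rcases lt_or_gt_of_ne (G.ne_of_adj huv) with h | h
    · refine ⟨(u, v), h, ⟨(slot_ge_iff h v.2).2 hru, u, v, h, huv, rfl⟩, ?_⟩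
      rw [min_eq_left hcd.le, max_eq_right hcd.le]
    · refine ⟨(v, u), h, ⟨(slot_ge_iff h u.2).2 hrv, v, u, h, huv.symm, rfl⟩, ?_⟩
      rw [min_comm, max_comm, min_eq_left hcd.le, max_eq_right hcd.le]

/-- **Block lemma.** If the code of `G` is minimal among the codes of its relabellings, then no
permutation fixing the vertices below `r` lowers the high part (top block) of the code. -/
theorem not_lt_hiPart_of_minimal {n r : ℕ} (G : SimpleGraph (Fin n))
    (hmin : ∀ σ : Equiv.Perm (Fin n), codeG G ≤ codeG (G.map σ))
    (σ : Equiv.Perm (Fin n)) (hfix : ∀ i : Fin n, i.val < r → σ i = i)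
    (τ : List (Fin n)) (hτ : ∀ i : Fin n, τ.getD i i = σ i) :
    ¬ recode n τ (hiPart (slot n r (r + 1)) (codeG G)) < hiPart (slot n r (r + 1)) (codeG G) := by
  rw [recode_hiPart_codeG G σ hfix τ hτ]
  intro hlt
  set B := slot n r (r + 1)
  set c := codeG G
  set c' := codeG (G.map σ)
  have h1 : c' / 2 ^ B < c / 2 ^ B := by
    rw [hiPart_eq, hiPart_eq] at hlt
    exact Nat.lt_of_mul_lt_mul_right hlt
  have h2 : c' < c := by
    have hm := Nat.mod_lt c' (Nat.two_pow_pos B)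
    have e1 := Nat.div_add_mod' c' (2 ^ B)
    have e2 := Nat.div_add_mod' c (2 ^ B)
    have h3 : c' / 2 ^ B * 2 ^ B + 2 ^ B ≤ c / 2 ^ B * 2 ^ B := by
      have := Nat.mul_le_mul_right (2 ^ B) (Nat.succ_le_of_lt h1)
      rwa [Nat.succ_mul] at this
    calc c' = c' / 2 ^ B * 2 ^ B + c' % 2 ^ B := e1.symm
      _ < c' / 2 ^ B * 2 ^ B + 2 ^ B := Nat.add_lt_add_left hm _
      _ ≤ c / 2 ^ B * 2 ^ B := h3
      _ ≤ c / 2 ^ B * 2 ^ B + c % 2 ^ B := Nat.le_add_right _ _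
      _ = c := e2
  exact absurd (hmin σ) (not_le.2 h2)

end Summit.CriticalPhenomena.PercolationContinuityZ3.Theorems.AdditiveGluing.Negative.Cert
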